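import Summits.ABC.ABC.Theses.CubicResolventAllowance
import HarnessLib

/-!
# stub-ideation k2 (RESHAPE) — generation 23 sketch for `stub_complexCubic` (crux `IndexSzpiro`, stmt-ABC-22740)

Companion to `STUB-IDEAS-stub_complexCubic-2.md` (gen 23).  Gens 1–22 of this slot stand BY REFERENCE
(`StubIdeas2G*Sketch.lean`, same directory).  This file types ONLY what gen 23 adds — the ε-AXIS GAUGE of the
COMPLEX half (FAMILY 2 «strengthen-to-simplify», floor located by the FAMILY-3 tower of gen 7):

* §1  `IndexSzpiroComplexGauge g` / `PolylogStubComplex A` (`Δ_min ≤ C·|d_K|·N⁶·(1+log N)^A` on the complex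
      `r = 0` class); CG1 `stubComplex_of_polylog : PolylogStubComplex A → Stub` for EVERY `A` (PROVED) — any
      polylog gauge is a legitimate SHARPENED TARGET for the registered stub;
* §2  the floor: the gen-7 doubling tower (`StubIdeas2G7.deepEvenComplexFamily`, VERIFIED there: `d_K < 0`,
      `|d_K| ∣ 1944`, `2^{6j+3}N⁶ ≤ 3²¹Δ_min`) carried as the NAMED INPUT `DeepEvenComplexFamilyGrowth` together
      with the one new archimedean clause `1 + log N_j ≤ c·4^j` (naive height is quartic under doubling, CG2);
      CG4 `not_polylogStubComplex_of_lt_three` (PROVED from the named input): `A < 3` is FALSE in-class.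
      So on the complex half, exactly as k3-real G5 found on the real half (`K₄₉`, `29`-adic EDS), the honest
      sharpened target is `PolylogStubComplex 3` and genus-≤ 1 tower mechanisms are capped at `(log N)³`.

Mirror of `StubIdeas3SketchG5.lean` §1 (real half) — a VARIANT by construction, filed so the complex stub has its
own calibrated target / `Disproof.lean` rider.  Nothing here is an arrow toward the stub.  `sorry` only in CG2
(M-sized prover work); everything else is kernel-checked.
-/

open Polynomial

set_option linter.dupNamespace false

namespace Summit.ABC.ABC.Cruxes.IndexSzpiro.StubIdeas2G23

open Summit.ABC.ABC.Theses.CubicResolventAllowance (IndexSzpiro)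
open WeierstrassCurve

/-! ## §0  The stub (verbatim) -/

/-- `stub_complexCubic`, verbatim (registered signature, skeleton sha d34fb8f2…). -/
def Stub : Prop :=
  ∀ ε : ℝ, 0 < ε → ∃ C : ℝ, ∀ (W : WeierstrassCurve ℚ) [W.IsElliptic] (K : Type) [Field K] [NumberField K],
    Irreducible W.twoTorsionPolynomial.toPoly → Module.finrank ℚ K = 3 →
    (∃ θ : K, aeval θ W.twoTorsionPolynomial.toPoly = 0) → NumberField.discr K < 0 →
    (W.minimalDiscriminantNorm ℤ : ℝ) ≤ C * |(NumberField.discr K : ℝ)| * (W.conductorNorm ℤ : ℝ) ^ (6 + ε)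

/-- (VERIFIED, trivial) the crux gives the stub by forgetting the sign. -/
theorem stub_of_indexSzpiro (h : IndexSzpiro) : Stub := by
  intro ε hε
  obtain ⟨C, hC⟩ := h ε hε
  exact ⟨C, fun W _ K _ _ hirr h3 hθ _ => hC W K hirr h3 hθ⟩

/-! ## §1  The ε-axis gauge on the complex half -/

/-- `IndexSzpiroComplexGauge g`: the complex-class index bound with the `ε`-slack replaced by a GAUGE `g(N)`:
`Δ_min ≤ C·|d_K|·N⁶·g(N)`. -/
def IndexSzpiroComplexGauge (g : ℕ → ℝ) : Prop :=
  ∃ C : ℝ, ∀ (W : WeierstrassCurve ℚ) [W.IsElliptic] (K : Type) [Field K] [NumberField K],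
    Irreducible W.twoTorsionPolynomial.toPoly → Module.finrank ℚ K = 3 →
    (∃ θ : K, aeval θ W.twoTorsionPolynomial.toPoly = 0) → NumberField.discr K < 0 →
    (W.minimalDiscriminantNorm ℤ : ℝ) ≤
      C * |(NumberField.discr K : ℝ)| * ((W.conductorNorm ℤ : ℝ) ^ (6 : ℕ) * g (W.conductorNorm ℤ))

/-- `PL_A` on the complex half: the polylogarithmic gauge `(1 + log N)^A`. -/
def PolylogStubComplex (A : ℝ) : Prop :=
  IndexSzpiroComplexGauge (fun N => (1 + Real.log N) ^ A)

theorem rpow_six_add (W : WeierstrassCurve ℚ) [W.IsElliptic] (ε : ℝ) :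
    (W.conductorNorm ℤ : ℝ) ^ (6 + ε) = (W.conductorNorm ℤ : ℝ) ^ (6 : ℕ) * (W.conductorNorm ℤ : ℝ) ^ ε := by
  have hN : (0 : ℝ) < (W.conductorNorm ℤ : ℝ) := by exact_mod_cast W.conductorNorm_pos_holds
  rw [Real.rpow_add hN, ← Real.rpow_natCast]
  norm_num

/-- (PROVED) the stub IS the family of power gauges `N^ε`, `ε > 0`. -/
theorem stub_iff_gauge : Stub ↔ ∀ ε : ℝ, 0 < ε → IndexSzpiroComplexGauge (fun N => (N : ℝ) ^ ε) := by
  refine forall₂_congr fun ε _ => ?_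
  constructor
  · rintro ⟨C, hC⟩
    refine ⟨C, fun W _ K _ _ hirr h3 hθ hd => ?_⟩
    rw [← rpow_six_add]
    exact hC W K hirr h3 hθ hd
  · rintro ⟨C, hC⟩
    refine ⟨C, fun W _ K _ _ hirr h3 hθ hd => ?_⟩
    rw [rpow_six_add]
    exact hC W K hirr h3 hθ hd

/-- (PROVED) gauge domination. -/
theorem gauge_mono {g₁ g₂ : ℕ → ℝ} {c : ℝ} (hc : 0 ≤ c) (hg₁ : ∀ N : ℕ, 1 ≤ N → 0 ≤ g₁ N)
    (hg : ∀ N : ℕ, 1 ≤ N → g₁ N ≤ c * g₂ N) : IndexSzpiroComplexGauge g₁ → IndexSzpiroComplexGauge g₂ := by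
  rintro ⟨C, hC⟩
  refine ⟨max C 0 * c, fun W _ K _ _ hirr h3 hθ hd => (hC W K hirr h3 hθ hd).trans ?_⟩
  have hN1 : 1 ≤ W.conductorNorm ℤ := W.conductorNorm_pos_holds
  have h0 : 0 ≤ |(NumberField.discr K : ℝ)| := abs_nonneg _
  have hN6 : 0 ≤ (W.conductorNorm ℤ : ℝ) ^ (6 : ℕ) := by positivity
  have hX : 0 ≤ |(NumberField.discr K : ℝ)| * ((W.conductorNorm ℤ : ℝ) ^ (6 : ℕ) * g₁ (W.conductorNorm ℤ)) :=
    mul_nonneg h0 (mul_nonneg hN6 (hg₁ _ hN1))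
  have _hc := hc
  calc C * |(NumberField.discr K : ℝ)| * ((W.conductorNorm ℤ : ℝ) ^ (6 : ℕ) * g₁ (W.conductorNorm ℤ))
      = C * (|(NumberField.discr K : ℝ)| * ((W.conductorNorm ℤ : ℝ) ^ (6 : ℕ) * g₁ (W.conductorNorm ℤ))) := by
        ring
    _ ≤ max C 0 * (|(NumberField.discr K : ℝ)| * ((W.conductorNorm ℤ : ℝ) ^ (6 : ℕ) * g₁ (W.conductorNorm ℤ))) :=
        mul_le_mul_of_nonneg_right (le_max_left _ _) hX
    _ ≤ max C 0 * (|(NumberField.discr K : ℝ)| * ((W.conductorNorm ℤ : ℝ) ^ (6 : ℕ) * (c * g₂ (W.conductorNorm ℤ)))) :=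
        mul_le_mul_of_nonneg_left (mul_le_mul_of_nonneg_left
          (mul_le_mul_of_nonneg_left (hg _ hN1) hN6) h0) (le_max_right _ _)
    _ = max C 0 * c * |(NumberField.discr K : ℝ)| * ((W.conductorNorm ℤ : ℝ) ^ (6 : ℕ) * g₂ (W.conductorNorm ℤ)) := by
        ring

/-- (PROVED; = k3-real G5 `one_add_log_rpow_le`) every polylog is dominated by every power on `x ≥ 1`. -/
theorem one_add_log_rpow_le (A ε : ℝ) (hε : 0 < ε) :
    ∃ c : ℝ, 0 < c ∧ ∀ x : ℝ, 1 ≤ x → (1 + Real.log x) ^ A ≤ c * x ^ ε := by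
  rcases le_or_gt A 0 with hA | hA
  · refine ⟨1, one_pos, fun x hx => ?_⟩
    have hlog : 0 ≤ Real.log x := Real.log_nonneg hx
    calc (1 + Real.log x) ^ A ≤ 1 := Real.rpow_le_one_of_one_le_of_nonpos (by linarith) hA
      _ ≤ 1 * x ^ ε := by rw [one_mul]; exact Real.one_le_rpow hx hε.le
  · set M : ℝ := max 1 (A / ε) with hM
    have hM1 : 1 ≤ M := le_max_left _ _
    have hM0 : 0 ≤ M := le_trans zero_le_one hM1
    refine ⟨M ^ A, Real.rpow_pos_of_pos (lt_of_lt_of_le one_pos hM1) A, fun x hx => ?_⟩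
    have hx0 : 0 < x := lt_of_lt_of_le one_pos hx
    have hlog : 0 ≤ Real.log x := Real.log_nonneg hx
    have hy : 1 + ε / A * Real.log x ≤ x ^ (ε / A) := by
      rw [Real.rpow_def_of_pos hx0, mul_comm (Real.log x)]
      linarith [Real.add_one_le_exp (ε / A * Real.log x)]
    have hyx : 0 ≤ ε / A * Real.log x := mul_nonneg (div_pos hε hA).le hlog
    have hone : (A / ε) * (ε / A) = 1 := by
      rw [div_mul_div_comm, mul_comm A ε, div_self (mul_ne_zero hε.ne' hA.ne')]
    have hlx : Real.log x = (A / ε) * (ε / A * Real.log x) := by rw [← mul_assoc, hone, one_mul]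
    have h2 : 1 + Real.log x ≤ M * (1 + ε / A * Real.log x) := by
      calc 1 + Real.log x = 1 + (A / ε) * (ε / A * Real.log x) := by rw [← hlx]
        _ ≤ M + M * (ε / A * Real.log x) :=
            add_le_add hM1 (mul_le_mul_of_nonneg_right (le_max_right _ _) hyx)
        _ = M * (1 + ε / A * Real.log x) := by ring
    have h3 : 1 + Real.log x ≤ M * x ^ (ε / A) := h2.trans (mul_le_mul_of_nonneg_left hy hM0)
    have hb0 : 0 ≤ 1 + Real.log x := by linarith
    calc (1 + Real.log x) ^ A ≤ (M * x ^ (ε / A)) ^ A := Real.rpow_le_rpow hb0 h3 hA.le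
      _ = M ^ A * (x ^ (ε / A)) ^ A := Real.mul_rpow hM0 (Real.rpow_nonneg hx0.le _)
      _ = M ^ A * x ^ ε := by rw [← Real.rpow_mul hx0.le, div_mul_cancel₀ ε hA.ne']

/-- **CG1 (PROVED).** Any polylogarithmic gauge implies the registered stub: `PL_A → stub_complexCubic`. -/
theorem stubComplex_of_polylog {A : ℝ} (h : PolylogStubComplex A) : Stub := by
  rw [stub_iff_gauge]
  intro ε hε
  obtain ⟨c, hc, hcx⟩ := one_add_log_rpow_le A ε hε
  refine gauge_mono hc.le (fun N hN => ?_) (fun N hN => hcx N (by exact_mod_cast hN)) h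
  have hlog : 0 ≤ Real.log (N : ℝ) := Real.log_nonneg (by exact_mod_cast hN)
  exact Real.rpow_nonneg (by linarith) _

theorem polylog_mono {A B : ℝ} (hAB : A ≤ B) : PolylogStubComplex A → PolylogStubComplex B := by
  refine gauge_mono (c := 1) zero_le_one (fun N hN => ?_) (fun N hN => ?_)
  · have h1 : (0 : ℝ) ≤ 1 + Real.log N := by
      have := Real.log_nonneg (show (1 : ℝ) ≤ (N : ℝ) by exact_mod_cast hN); linarith
    exact Real.rpow_nonneg h1 _
  · rw [one_mul]
    have h1 : (1 : ℝ) ≤ 1 + Real.log N := by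
      have := Real.log_nonneg (show (1 : ℝ) ≤ (N : ℝ) by exact_mod_cast hN); linarith
    exact Real.rpow_le_rpow_of_exponent_le h1 hAB

/-! ## §2  The floor `A ≥ 3`: the gen-7 doubling tower with its archimedean size -/

/-- Naive height of a rational number. -/
def ratHeight (q : ℚ) : ℕ := max q.num.natAbs q.den

/-- **CG2 (M; the one new input).** Naive height is at most QUARTIC under doubling on `E₀ : Y² = X³ + 18³`:
`x(2P) = X(X³ − 8·5832)/(4Y²)`, so `H(x(2P)) ≤ (1 + 8·5832)·H(X)⁴` (write `X = p/q`; numerator `p(p³ − 46656q³)`,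
denominator `4q(p³ + 5832q³)`, both `≤ 46657·max(|p|,q)⁴`; reduction only lowers the height). [folklore;
SilvermanAEC2009 VIII.4] -/
theorem ratHeight_xDouble_le (X Y : ℚ) (hY : Y ≠ 0) (h : Y ^ 2 = X ^ 3 + 5832) :
    ratHeight ((X ^ 4 - 8 * 5832 * X) / (4 * Y ^ 2)) ≤ 46657 * ratHeight X ^ 4 := by
  sorry

/-- **The named input** = gen-7 `StubIdeas2G7.deepEvenComplexFamily` (VERIFIED there modulo its M-sized orbit
lemmas, split further in gen 8/9) **plus** the growth clause `1 + log N_j ≤ c·4^j` (CG3, M: from CG2 iterated —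
`log H(X_j) ≤ 4^j·(log H(X₀) + log 46657/3)` — and `N_j ∣ Δ_min(W_j) ≤ |Δ(hesse a n)| = 27|n|³|a³−n³|³ ≤ 216·H(λ_j)¹²`
(`conductorNorm_dvd_minimalDiscriminantNorm`), `H(λ_j) ≤ 37·H(X_j)` for `λ_j = 1 − 54/(X_j + 18) = (X_j − 36)/(X_j + 18)`). -/
def DeepEvenComplexFamilyGrowth : Prop :=
  ∃ c : ℝ, ∀ j : ℕ, ∃ (W : WeierstrassCurve ℚ) (_ : W.IsElliptic), Irreducible W.twoTorsionPolynomial.toPoly ∧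
      (∀ (K : Type) [Field K] [NumberField K], Module.finrank ℚ K = 3 →
        (∃ θ : K, aeval θ W.twoTorsionPolynomial.toPoly = 0) →
          NumberField.discr K < 0 ∧ (NumberField.discr K).natAbs ∣ 1944) ∧
      2 ^ (6 * j + 3) * W.conductorNorm ℤ ^ 6 ≤ 3 ^ 21 * W.minimalDiscriminantNorm ℤ ∧
      1 + Real.log (W.conductorNorm ℤ : ℝ) ≤ c * (2 : ℝ) ^ (2 * j)

/-- (VERIFIED; = k2 gen 5/7/20 `exists_resolventField`) a stem field of the irreducible 2-division cubic. -/
theorem exists_resolventField (W : WeierstrassCurve ℚ) (hirr : Irreducible W.twoTorsionPolynomial.toPoly) :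
    ∃ (K : Type) (_ : Field K) (_ : NumberField K),
      Module.finrank ℚ K = 3 ∧ ∃ θ : K, aeval θ W.twoTorsionPolynomial.toPoly = 0 := by
  haveI : Fact (Irreducible W.twoTorsionPolynomial.toPoly) := ⟨hirr⟩
  have hdeg : W.twoTorsionPolynomial.toPoly.natDegree = 3 :=
    Cubic.natDegree_of_a_ne_zero (by norm_num [WeierstrassCurve.twoTorsionPolynomial])
  have hfin : Module.finrank ℚ (AdjoinRoot W.twoTorsionPolynomial.toPoly) = 3 := by
    rw [(AdjoinRoot.powerBasis hirr.ne_zero).finrank, AdjoinRoot.powerBasis_dim, hdeg]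
  have hroot := AdjoinRoot.aeval_eq (f := W.twoTorsionPolynomial.toPoly) W.twoTorsionPolynomial.toPoly
  rw [AdjoinRoot.mk_self] at hroot
  have keyfin : ∀ inst : Module ℚ (AdjoinRoot W.twoTorsionPolynomial.toPoly),
      @Module.finrank ℚ (AdjoinRoot W.twoTorsionPolynomial.toPoly) _ _ inst = 3 := by
    intro inst
    obtain rfl := Subsingleton.elim inst
      (@Algebra.toModule _ _ _ _ (AdjoinRoot.instAlgebra W.twoTorsionPolynomial.toPoly))
    exact hfin
  have keyroot : ∀ inst : Algebra ℚ (AdjoinRoot W.twoTorsionPolynomial.toPoly),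
      @aeval ℚ (AdjoinRoot W.twoTorsionPolynomial.toPoly) _ _ inst
        (AdjoinRoot.root W.twoTorsionPolynomial.toPoly) W.twoTorsionPolynomial.toPoly = 0 := by
    intro inst
    obtain rfl := Subsingleton.elim inst (AdjoinRoot.instAlgebra W.twoTorsionPolynomial.toPoly)
    exact hroot
  exact ⟨AdjoinRoot W.twoTorsionPolynomial.toPoly, inferInstance, inferInstance, keyfin _,
    AdjoinRoot.root _, keyroot _⟩

/-- **CG4 (PROVED from the named input).**  On the complex half the polylog exponent is `≥ 3`: member `j` of the
tower and `PL_B` (`B = max A 0 < 3`) give `2^{6j+3}·N⁶ ≤ 3²¹·C·1944·N⁶·(c·4^j)^B`, i.e. `(2^{6−2B})^j ≤ C'` for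
all `j` — absurd. -/
theorem not_polylogStubComplex_of_lt_three (hF : DeepEvenComplexFamilyGrowth) {A : ℝ} (hA : A < 3) :
    ¬ PolylogStubComplex A := by
  intro hPL
  set B : ℝ := max A 0 with hBdef
  have hB0 : 0 ≤ B := le_max_right _ _
  have hB3 : B < 3 := max_lt hA (by norm_num)
  obtain ⟨C, hC⟩ := polylog_mono (le_max_left A 0) hPL
  obtain ⟨c, hc⟩ := hF
  -- the constant absorbing everything but the `j`-dependence
  set c₁ : ℝ := max c 1 with hc₁
  have hc₁1 : 1 ≤ c₁ := le_max_right _ _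
  have hc₁0 : 0 ≤ c₁ := zero_le_one.trans hc₁1
  set C₂ : ℝ := 3 ^ 21 * (max C 0 * 1944) * c₁ ^ B with hC₂
  have hC₂0 : 0 ≤ C₂ := by positivity
  -- choose `j` with `C₂ < (2^(6-2B))^j`
  have h2 : (1 : ℝ) < (2 : ℝ) ^ (6 - 2 * B) := Real.one_lt_rpow (by norm_num) (by linarith)
  obtain ⟨j, hj⟩ := pow_unbounded_of_one_lt C₂ h2
  obtain ⟨W, hE, hirr, hK, hineq, hlog⟩ := hc j
  haveI := hE
  obtain ⟨K, _, _, h3, hθ⟩ := exists_resolventField W hirr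
  obtain ⟨hneg, hdvd⟩ := hK K h3 hθ
  have hb := hC W K hirr h3 hθ hneg
  have hdK : |(NumberField.discr K : ℝ)| ≤ 1944 := by
    have h := Nat.le_of_dvd (by norm_num) hdvd
    rw [← Int.cast_abs, Int.abs_eq_natAbs]
    exact_mod_cast h
  have hN1 : (1 : ℝ) ≤ (W.conductorNorm ℤ : ℝ) := by exact_mod_cast W.conductorNorm_pos_holds
  have hN0 : (0 : ℝ) < (W.conductorNorm ℤ : ℝ) := by linarith
  have hN6 : (0 : ℝ) < (W.conductorNorm ℤ : ℝ) ^ (6 : ℕ) := by positivity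
  have hineqR : (2 : ℝ) ^ (6 * j + 3) * (W.conductorNorm ℤ : ℝ) ^ (6 : ℕ) ≤
      3 ^ 21 * (W.minimalDiscriminantNorm ℤ : ℝ) := by exact_mod_cast hineq
  -- the gauge on the member: `(1 + log N)^B ≤ c₁^B · (2^(2j))^B`
  have hT1 : (1 : ℝ) ≤ (2 : ℝ) ^ (2 * j) := one_le_pow₀ (by norm_num)
  have hT0 : (0 : ℝ) < (2 : ℝ) ^ (2 * j) := by positivity
  have hg0 : (0 : ℝ) ≤ 1 + Real.log (W.conductorNorm ℤ : ℝ) := by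
    have := Real.log_nonneg hN1; linarith
  have hlog' : 1 + Real.log (W.conductorNorm ℤ : ℝ) ≤ c₁ * (2 : ℝ) ^ (2 * j) :=
    hlog.trans (mul_le_mul_of_nonneg_right (le_max_left _ _) hT0.le)
  have hgauge : (1 + Real.log (W.conductorNorm ℤ : ℝ)) ^ B ≤ c₁ ^ B * ((2 : ℝ) ^ (2 * j)) ^ B := by
    rw [← Real.mul_rpow hc₁0 hT0.le]
    exact Real.rpow_le_rpow hg0 hlog' hB0
  have hTB0 : (0 : ℝ) < ((2 : ℝ) ^ (2 * j)) ^ B := Real.rpow_pos_of_pos hT0 _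
  -- `PL_B` on the member, constants made nonnegative
  have hC0 : 0 ≤ max C 0 := le_max_right _ _
  have hb' : (W.minimalDiscriminantNorm ℤ : ℝ) ≤
      max C 0 * 1944 * ((W.conductorNorm ℤ : ℝ) ^ (6 : ℕ) * (c₁ ^ B * ((2 : ℝ) ^ (2 * j)) ^ B)) := by
    have h0 : (0 : ℝ) ≤ (W.conductorNorm ℤ : ℝ) ^ (6 : ℕ) * (1 + Real.log (W.conductorNorm ℤ : ℝ)) ^ B :=
      mul_nonneg hN6.le (Real.rpow_nonneg hg0 _)
    calc (W.minimalDiscriminantNorm ℤ : ℝ)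
        ≤ C * |(NumberField.discr K : ℝ)| *
            ((W.conductorNorm ℤ : ℝ) ^ (6 : ℕ) * (1 + Real.log (W.conductorNorm ℤ : ℝ)) ^ B) := hb
      _ ≤ max C 0 * |(NumberField.discr K : ℝ)| *
            ((W.conductorNorm ℤ : ℝ) ^ (6 : ℕ) * (1 + Real.log (W.conductorNorm ℤ : ℝ)) ^ B) :=
          mul_le_mul_of_nonneg_right (mul_le_mul_of_nonneg_right (le_max_left _ _) (abs_nonneg _)) h0
      _ ≤ max C 0 * 1944 *
            ((W.conductorNorm ℤ : ℝ) ^ (6 : ℕ) * (1 + Real.log (W.conductorNorm ℤ : ℝ)) ^ B) :=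
          mul_le_mul_of_nonneg_right (mul_le_mul_of_nonneg_left hdK hC0) h0
      _ ≤ max C 0 * 1944 * ((W.conductorNorm ℤ : ℝ) ^ (6 : ℕ) * (c₁ ^ B * ((2 : ℝ) ^ (2 * j)) ^ B)) :=
          mul_le_mul_of_nonneg_left (mul_le_mul_of_nonneg_left hgauge hN6.le) (by positivity)
  -- combine with the tower inequality and cancel `N^6 > 0`: `2^(6j+3) ≤ C₂ · (2^(2j))^B`
  have hkey : (2 : ℝ) ^ (6 * j + 3) ≤ C₂ * ((2 : ℝ) ^ (2 * j)) ^ B := by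
    have h1 : (2 : ℝ) ^ (6 * j + 3) * (W.conductorNorm ℤ : ℝ) ^ (6 : ℕ) ≤
        C₂ * ((2 : ℝ) ^ (2 * j)) ^ B * (W.conductorNorm ℤ : ℝ) ^ (6 : ℕ) := by
      calc (2 : ℝ) ^ (6 * j + 3) * (W.conductorNorm ℤ : ℝ) ^ (6 : ℕ)
          ≤ 3 ^ 21 * (W.minimalDiscriminantNorm ℤ : ℝ) := hineqR
        _ ≤ 3 ^ 21 * (max C 0 * 1944 * ((W.conductorNorm ℤ : ℝ) ^ (6 : ℕ) * (c₁ ^ B * ((2 : ℝ) ^ (2 * j)) ^ B))) :=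
            mul_le_mul_of_nonneg_left hb' (by norm_num)
        _ = C₂ * ((2 : ℝ) ^ (2 * j)) ^ B * (W.conductorNorm ℤ : ℝ) ^ (6 : ℕ) := by rw [hC₂]; ring
    exact le_of_mul_le_mul_right h1 hN6
  have hkey' : (2 : ℝ) ^ (6 * j) ≤ C₂ * ((2 : ℝ) ^ (2 * j)) ^ B :=
    (pow_le_pow_right₀ (by norm_num) (by omega)).trans hkey
  -- `2^(6j) ≤ C₂·(2^(2j))^B < (2^(6-2B))^j · (2^(2j))^B = 2^(6j)`
  have hlt : (2 : ℝ) ^ (6 * j) < ((2 : ℝ) ^ (6 - 2 * B)) ^ j * ((2 : ℝ) ^ (2 * j)) ^ B :=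
    hkey'.trans_lt (mul_lt_mul_of_pos_right hj hTB0)
  have hexp : ((2 : ℝ) ^ (6 - 2 * B)) ^ j * ((2 : ℝ) ^ (2 * j)) ^ B = (2 : ℝ) ^ ((6 * j : ℕ) : ℝ) := by
    rw [← Real.rpow_natCast ((2 : ℝ) ^ (6 - 2 * B)) j, ← Real.rpow_mul (by norm_num),
      ← Real.rpow_natCast (2 : ℝ) (2 * j), ← Real.rpow_mul (by norm_num), ← Real.rpow_add (by norm_num)]
    congr 1; push_cast; ring
  have hge : (2 : ℝ) ^ ((6 * j : ℕ) : ℝ) = (2 : ℝ) ^ (6 * j) := Real.rpow_natCast _ _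
  linarith [hexp ▸ hlt, hge]

/-- **Summary (PROVED modulo the named input).**  The registered ε-form is bracketed on the complex half:
`PL_A` is false for `A < 3`, and every `PL_A` implies the stub — the sharpened prover target is `PL_3`. -/
theorem gauge_bracket (hF : DeepEvenComplexFamilyGrowth) :
    (∀ A : ℝ, A < 3 → ¬ PolylogStubComplex A) ∧ (∀ A : ℝ, PolylogStubComplex A → Stub) :=
  ⟨fun _ hA => not_polylogStubComplex_of_lt_three hF hA, fun _ h => stubComplex_of_polylog h⟩

end Summit.ABC.ABC.Cruxes.IndexSzpiro.StubIdeas2G23
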